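import Literature.AlgebraicGeometry.HodgeTheory.AlgebraicityLocusFromFacts
import HarnessLib

/-!
# Complex points over the generic part of an irreducible closed subset are path connected

Topic `Literature/AlgebraicGeometry/HodgeTheory` (family `hodge`). Two consequences of the proved
generic local path-connectedness theorem of `AlgebraicityLocusFromFacts`
(`exists_opens_locallyPathConnectedSpace_setOf_pt_mem`: for `T` locally of finite type over `ℂ`
and `Y ⊆ T` closed irreducible, the complex points over `Y ∩ O` are locally path connected for all
opens `O` inside some open `O₁` meeting `Y`) combined with the connectedness of those complex
points (SGA1 XII Prop. 2.4; Shafarevich, Book 3, VII §2 Thm. 7.1; the tree's proved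
`Motives.ComplexPoints.isConnected_setOf_pt_mem_inter_of_isIrreducible`):

* `exists_opens_isPathConnected_setOf_pt_mem` — the complex points over the generic part of an
  irreducible closed `Y ⊆ T` are PATH connected (connected and locally path connected);
* `exists_opens_isPathConnected_setOf_pt_mem_of_irreducibleSpace` — the case `Y = T` of an
  irreducible `T`: the complex points of every non-empty open inside some non-empty open `O₁` are
  path connected;
* `exists_isClosed_setOf_mem_algebraicClasses_eq_iUnion_of_mumford_of_genericPairTriviality` —
  the structure theorem on algebraicity loci
  (`charlesSchnell_algebraicityLocus_iUnion_closed_of_mumford_of_genericPairTriviality`) unfolded at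
  a given family and class, for consumers: granted Mumford's curve lemma and Verdier's generic pair
  triviality, the algebraicity locus of `A ∈ H²ᵖ(𝒳(ℂ); ℂ)` in a smooth projective family over a
  smooth quasi-projective base is `⋃_j W_j(ℂ)` for countably many Zariski-closed `W_j`.

Everything here is proved; no named fact is introduced.

## References

* [SGA1] A. Grothendieck, M. Raynaud, SGA 1, Exp. XII Prop. 2.4.
* [Shafarevich1994] I. R. Shafarevich, Basic Algebraic Geometry 2, Book 3, Ch. VII §2 Thm. 7.1.
* [Matsumura1987] H. Matsumura, Commutative Ring Theory (1987), §30, Cor. to Thm. 30.5.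
* [Verdier1976] J.-L. Verdier, Stratifications de Whitney et théorème de Bertini–Sard, Invent.
  Math. 36 (1976), Thm. (3.3), Thm. (4.14), Cor. (5.1).
* [CharlesSchnell2014Notes] F. Charles, C. Schnell, Notes on absolute Hodge classes (2014),
  Prop. 11.3.11 (proof).
-/

noncomputable section

open CategoryTheory AlgebraicGeometry Set MonoidalCategory CartesianMonoidalCategory
open _root_.Topology TopologicalSpace Filter
open Literature.AlgebraicGeometry.Motives

namespace Literature.AlgebraicGeometry.HodgeTheory

section HodgeTheory

/-! ### Path-connectedness of the complex points over the generic part -/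

section PathConnected

variable {T : Motives.SchemeOver ℂ}

/-- **The complex points over the generic part of an irreducible closed subset are path
connected.** For `T` locally of finite type over `ℂ` and `Y ⊆ T` closed irreducible there is an
open `O₁` meeting `Y` such that for every open `O ≤ O₁` meeting `Y` the subspace
`{y ∈ T(ℂ) | pt y ∈ Y ∩ O}` of `T(ℂ)` is path connected: it is connected (SGA1 XII Prop. 2.4 for
the irreducible `Y ∩ O`, `Motives.ComplexPoints.isConnected_setOf_pt_mem_inter_of_isIrreducible`)
and locally path connected (`exists_opens_locallyPathConnectedSpace_setOf_pt_mem`: the regular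
locus of the reduced subscheme on `Y` is a dense open smooth over `ℂ`), and a connected locally
path connected space is path connected. [cite: SGA1, Exp. XII Prop. 2.4]
[cite: Matsumura1987, §30, Cor. to Thm. 30.5] -/
theorem exists_opens_isPathConnected_setOf_pt_mem [LocallyOfFiniteType T.hom] {Y : Set T.left}
    (hYc : IsClosed Y) (hY : IsIrreducible Y) :
    ∃ O₁ : T.left.Opens, (Y ∩ (O₁ : Set T.left)).Nonempty ∧
      ∀ O : T.left.Opens, O ≤ O₁ → (Y ∩ (O : Set T.left)).Nonempty →
        IsPathConnected {y : Motives.ComplexPoints T | y.pt ∈ Y ∧ y.pt ∈ (O : Set T.left)} := by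
  obtain ⟨O₁, hYO₁, hlpc⟩ := exists_opens_locallyPathConnectedSpace_setOf_pt_mem (T := T) hYc hY
  refine ⟨O₁, hYO₁, fun O hO hYO => ?_⟩
  have hconn : IsConnected
      {y : Motives.ComplexPoints T | y.pt ∈ Y ∧ y.pt ∈ (O : Set T.left)} :=
    Motives.ComplexPoints.isConnected_setOf_pt_mem_inter_of_isIrreducible T hYc hY O hYO
  haveI : LocallyPathConnectedSpace
      ↥{y : Motives.ComplexPoints T | y.pt ∈ Y ∧ y.pt ∈ (O : Set T.left)} := hlpc O hO
  haveI : ConnectedSpace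
      ↥{y : Motives.ComplexPoints T | y.pt ∈ Y ∧ y.pt ∈ (O : Set T.left)} :=
    isConnected_iff_connectedSpace.1 hconn
  exact isPathConnected_iff_pathConnectedSpace.2 (pathConnectedSpace_iff_connectedSpace.2 ‹_›)

/-- **The complex points of the generic part of an irreducible `ℂ`-scheme locally of finite type
are path connected**: the case `Y = T` of `exists_opens_isPathConnected_setOf_pt_mem` — there is
a non-empty open `O₁ ⊆ T` such that `O(ℂ) = {y ∈ T(ℂ) | pt y ∈ O}` is path connected for every
non-empty open `O ≤ O₁`. [cite: SGA1, Exp. XII Prop. 2.4] [cite: Matsumura1987, §30, Cor. to Thm. 30.5] -/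
theorem exists_opens_isPathConnected_setOf_pt_mem_of_irreducibleSpace [LocallyOfFiniteType T.hom]
    [IrreducibleSpace T.left] :
    ∃ O₁ : T.left.Opens, (O₁ : Set T.left).Nonempty ∧
      ∀ O : T.left.Opens, O ≤ O₁ → (O : Set T.left).Nonempty →
        IsPathConnected {y : Motives.ComplexPoints T | y.pt ∈ (O : Set T.left)} := by
  obtain ⟨O₁, hO₁, h⟩ := exists_opens_isPathConnected_setOf_pt_mem (T := T) isClosed_univ
    (IrreducibleSpace.isIrreducible_univ T.left)
  refine ⟨O₁, by simpa using hO₁, fun O hO hOne => ?_⟩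
  have h' := h O hO (by simpa using hOne)
  have e : {y : Motives.ComplexPoints T | y.pt ∈ (Set.univ : Set T.left) ∧
      y.pt ∈ (O : Set T.left)} = {y | y.pt ∈ (O : Set T.left)} := by
    ext y
    simp
  rwa [e] at h'

end PathConnected

/-! ### The structure theorem, unfolded at a given family and class -/

section Unfolded

/-- **The structure theorem on algebraicity loci, unfolded**: granted Mumford's curve lemma `hM`
(the named fact `Motives.mumford_smoothCurve_through_two_points`) and Verdier's generic local
triviality of pairs `hGT` (Verdier 1976, (2.2) + (3.3) + (4.14), Cor. (5.1); the statement of the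
named fact `Motives.Verdier1976_genericLocalTriviality`), for a smooth projective family
`f : 𝒳 ⟶ S` of relative dimension `n` over a smooth quasi-projective `S` with `𝒳` quasi-projective
and a class `A ∈ H²ᵖ(𝒳(ℂ); ℂ)`, there are countably many Zariski-closed `W_j ⊆ S` with
`{t ∈ S(ℂ) | A|_{𝒳_t} algebraic} = ⋃_j W_j(ℂ)`
(`charlesSchnell_algebraicityLocus_iUnion_closed_of_mumford_of_genericPairTriviality` applied to the
data). [cite: CharlesSchnell2014Notes, Prop. 11.3.11 (proof)]
[cite: Verdier1976, Thm. (3.3), Thm. (4.14), Cor. (5.1)] -/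
theorem exists_isClosed_setOf_mem_algebraicClasses_eq_iUnion_of_mumford_of_genericPairTriviality
    (hM : Motives.mumford_smoothCurve_through_two_points)
    (hGT : ∀ ⦃X T' : Motives.SchemeOver ℂ⦄ (g : X ⟶ T'), IsSeparated T'.hom →
      LocallyOfFiniteType T'.hom → CompactSpace T'.left → IsProper g.left →
      ∀ ⦃ι : Type⦄ [Finite ι] (C : ι → Set X.left), (∀ i, IsClosed (C i)) →
      ∀ ⦃Y : Set T'.left⦄, IsClosed Y → IsIrreducible Y →
        ∃ O : T'.left.Opens, (Y ∩ (O : Set T'.left)).Nonempty ∧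
          ∀ y₀ : Motives.ComplexPoints T', y₀.pt ∈ Y ∧ y₀.pt ∈ (O : Set T'.left) →
            ∃ V : Set (Motives.ComplexPoints T'),
              V ⊆ {y | y.pt ∈ Y ∧ y.pt ∈ (O : Set T'.left)} ∧
              V ∈ 𝓝[{y | y.pt ∈ Y ∧ y.pt ∈ (O : Set T'.left)}] y₀ ∧
              ∃ φ : ↥V × {x : Motives.ComplexPoints X // AlgPoints.map g x = y₀} ≃ₜ
                  {x : Motives.ComplexPoints X // AlgPoints.map g x ∈ V},
                (∀ p, AlgPoints.map g ((φ p : {x : Motives.ComplexPoints X //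
                    AlgPoints.map g x ∈ V}) : Motives.ComplexPoints X) =
                  (p.1 : Motives.ComplexPoints T')) ∧
                (∀ p i, ((φ p : {x : Motives.ComplexPoints X // AlgPoints.map g x ∈ V}) :
                    Motives.ComplexPoints X).pt ∈ C i ↔
                  ((p.2 : {x : Motives.ComplexPoints X // AlgPoints.map g x = y₀}) :
                    Motives.ComplexPoints X).pt ∈ C i))
    {𝒳 S : Motives.SchemeOver ℂ} (f : 𝒳 ⟶ S) (n p : ℕ) (h𝒳 : IsQuasiProjectiveOver 𝒳)
    (hS : IsQuasiProjectiveOver S) (hSsm : Smooth S.hom)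
    (hfam : Motives.IsSmoothProjectiveFamily f n) (A : complexBetti 𝒳 (2 * p)) :
    ∃ W : ℕ → Set S.left, (∀ j, IsClosed (W j)) ∧
      {t : Motives.ComplexPoints S |
          complexBetti.map (Motives.fiberι f t) (2 * p) A ∈
            algebraicClasses (Motives.fiberOver f t) p} =
        ⋃ j, {t | t.pt ∈ W j} :=
  charlesSchnell_algebraicityLocus_iUnion_closed_of_mumford_of_genericPairTriviality hM hGT f n p
    h𝒳 hS hSsm hfam A

end Unfolded

end HodgeTheory

end Literature.AlgebraicGeometry.HodgeTheory

end
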